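import Summits.ResolutionOfSingularities.ResolutionOfSingularities.Theorems.EquisingularLiftEquisingularLiftNatSplitNodeBlowupChart
import Summits.ResolutionOfSingularities.ResolutionOfSingularities.Theorems.EquisingularLiftEquisingularLiftNatResidueHypDefsE3
import Summits.ResolutionOfSingularities.ResolutionOfSingularities.Theorems.EquisingularLiftCampaignW45bBlowupStalkDictionary
import Summits.ResolutionOfSingularities.ResolutionOfSingularities.Theorems.EquisingularLiftEquisingularLiftNatConeRoundCartier
import Summits.ResolutionOfSingularities.ResolutionOfSingularities.Theorems.EquisingularLiftEquisingularLiftNatStrictTransformVanishingIdeal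
import Summits.ResolutionOfSingularities.ResolutionOfSingularities.Theorems.EquisingularLiftEquisingularLiftNatFatTouchNotFinishing
import Literature.AlgebraicGeometry.Resolution.StrictTransformCurveDelta
import HarnessLib

/-!
# [OURS · L1 W4.5(b) · EL♮(3) · door ν4, D7 brick HNODE, core P5] THE NOSE'S REDUCED STRICT TRANSFORM IS REGULAR OVER THE NODE

res-L1-w45b-stub-2 g17 (HNODE pen). `--supports stmt-ResolutionOfSingularities-20148 --as helper`, no claim, counted 0. OURS; NOT a statement of
[Hironaka2017]; AI-written, weaker than expert review. EL♮(3) is NOT proved here; char-p resolution is NOT proved anywhere in this tree. DEF-FREE.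

`Equinodal.redSub_strictTransform_regular_over_node` — P5 of HNODE in scheme form: in the point-step model square (stage `σ'`, `j : G → X'`, section `s`
with `s 𝔪 = j x` and `ker s · 𝒪_G = 𝓘⟨x⟩`, `υ = Bl_x G`), for the nose model `𝓦 ≤ ker s` with reduced trace `𝓘⟨W⟩` and a `SplitNodeAt X' 𝓛 𝓦 (ker s) (s 𝔪)`
package with `𝓛 ≤ 𝓦`, the reduced strict transform `W̃' = redSub G' (closure υ⁻¹(W ∖ {x}))` is REGULAR at every point over `x`.  Proof: `W̃' → W̃` is a
blow-up of `W̃` along `𝓘⟨x⟩|_{W̃}` (080E, `isBlowup_subscheme_strictTransformIdeal_of_idealSheaf` + `strictTransformIdeal_vanishingIdeal_eq`), whose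
stalk at the point over `x` is `𝔪 = (ū, v̄)`; the package, pushed through `𝒪_{X',jx} → 𝒪_{G,x} → 𝒪_{W̃,x}` (which kills `𝓦_{jx} ⊇ 𝓛_{jx}`), gives
`ᾱū² + β̄ūv̄ + γ̄v̄² + η̄ = 0`, `η̄ ∈ 𝔪³`, unit discriminant; the stalk of `W̃'` is a localisation of a chart `𝒪_{W̃,x}[𝔪/c_j]` at a prime over `𝔪`
(✓ `exists_blowupAlgebra_stalk_ringEquiv_of_eq`), regular by ✓ `SplitNodeChart.isRegularLocalRing_localization` (either chart, by the symmetry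
`ū ↔ v̄`).  No dimension hypothesis, every characteristic.
-/

set_option linter.dupNamespace false
set_option linter.overlappingInstances false

noncomputable section

open CategoryTheory CategoryTheory.Limits AlgebraicGeometry TopologicalSpace Topology IsLocalRing
open Literature.AlgebraicGeometry.Resolution
open AlgebraicGeometry.Scheme.IdealSheafData

namespace Summit.ResolutionOfSingularities.ResolutionOfSingularities.Cruxes.EquisingularLiftNat.Sections.Equinodal

/-- The chart theorem with the centre ideal and the chart element as parameters (for use under the stalk dictionary, whose chart index is
bound). [folklore] -/
theorem SplitNodeChart.isRegularLocalRing_localization_of_eq {D : Type} [CommRing D] [IsLocalRing D] [IsNoetherianRing D]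
    (U V α β γ η : D) (I : Ideal D) (a : D) (hI : I = Ideal.span {U, V}) (ha : a = V) (h𝔪 : maximalIdeal D = Ideal.span {U, V})
    (hrel : α * U ^ 2 + β * U * V + γ * V ^ 2 + η = 0) (hη : η ∈ Ideal.span {U, V} ^ 3) (hdisc : IsUnit (β ^ 2 - 4 * α * γ))
    (𝔔 : Ideal (blowupAlgebra I a)) (hprime : 𝔔.IsPrime) (h𝔔 : 𝔔.comap (algebraMap D (blowupAlgebra I a)) = maximalIdeal D)
    (L : Type) [CommRing L] [Algebra (blowupAlgebra I a) L] [IsLocalization.AtPrime L 𝔔] [IsLocalRing L] : IsRegularLocalRing L := by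
  subst hI ha
  haveI := hprime
  exact SplitNodeChart.isRegularLocalRing_localization U a α β γ η h𝔪 hrel hη hdisc 𝔔 h𝔔 L

/-- **P5 of HNODE: the reduced strict transform of the nose is regular over the node.**  See the module docstring. [OURS · counted 0] -/
theorem redSub_strictTransform_regular_over_node (O : Type) [CommRing O] [IsLocalRing O] {X' G G' : Scheme.{0}} [IsLocallyNoetherian X']
    [IsIntegral G] [IsLocallyNoetherian G] [IsLocallyNoetherian G'] (j : G ⟶ X') (s : Spec (.of O) ⟶ X')
    (υ : G' ⟶ G) (x : G) (hx : IsClosed ({x} : Set G)) (hυ : IsBlowup υ (vanishingIdeal ⟨{x}, hx⟩)) (hss₀ : s (closedPoint O) = j x)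
    (hCD : s.ker.comap j = vanishingIdeal ⟨{x}, hx⟩)
    (𝓛 𝓦 : X'.IdealSheafData) (h𝓛𝓦 : 𝓛 ≤ 𝓦) (W : Set G) (hW : IsClosed W) (h𝓦tr : 𝓦.comap j = vanishingIdeal (⟨W, hW⟩ : Closeds G))
    (hsplit : SplitNodeAt X' 𝓛 𝓦 s.ker (s (closedPoint O))) :
    ∀ z : ↥(redSub G' (closure (υ ⁻¹' (W \ {x}))) isClosed_closure),
      υ (redSubι G' (closure (υ ⁻¹' (W \ {x}))) isClosed_closure z) = x →
      IsRegularLocalRing ((redSub G' (closure (υ ⁻¹' (W \ {x}))) isClosed_closure).presheaf.stalk z) := by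
  intro z hz
  classical
  haveI : IsLocallyNoetherian (redSub G W hW) := LocallyOfFiniteType.isLocallyNoetherian (f := redSubι G W hW)
  haveI : IsLocallyNoetherian (redSub G' (closure (υ ⁻¹' (W \ {x}))) isClosed_closure) :=
    LocallyOfFiniteType.isLocallyNoetherian (f := redSubι G' (closure (υ ⁻¹' (W \ {x}))) isClosed_closure)
  have hxsupp : ((vanishingIdeal ⟨{x}, hx⟩ : G.IdealSheafData).support : Set G) = {x} :=
    Scheme.IdealSheafData.coe_support_vanishingIdeal _
  -- `W̃' → W̃` is the blow-up of `W̃` along `𝓘⟨x⟩|_{W̃}`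
  have hStW : strictTransformIdeal υ (vanishingIdeal ⟨{x}, hx⟩) (vanishingIdeal ⟨W, hW⟩) =
      vanishingIdeal (⟨closure (υ ⁻¹' (W \ {x})), isClosed_closure⟩ : Closeds G') := by
    rw [strictTransformIdeal_vanishingIdeal_eq υ _ hυ W hW]
    exact congrArg vanishingIdeal (Closeds.ext (by change closure (υ ⁻¹' (W \ _)) = closure (υ ⁻¹' (W \ {x})); rw [hxsupp]))
  have hpack : ∃ πD : redSub G' (closure (υ ⁻¹' (W \ {x}))) isClosed_closure ⟶ redSub G W hW,
      πD ≫ redSubι G W hW = redSubι G' (closure (υ ⁻¹' (W \ {x}))) isClosed_closure ≫ υ ∧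
      IsBlowup πD (((vanishingIdeal ⟨{x}, hx⟩ : G.IdealSheafData)).comap (redSubι G W hW)) := by
    have h0 : ∃ πD : (strictTransformIdeal υ (vanishingIdeal ⟨{x}, hx⟩) (vanishingIdeal ⟨W, hW⟩)).subscheme ⟶ redSub G W hW,
        πD ≫ redSubι G W hW = (strictTransformIdeal υ (vanishingIdeal ⟨{x}, hx⟩) (vanishingIdeal ⟨W, hW⟩)).subschemeι ≫ υ ∧
        IsBlowup πD (((vanishingIdeal ⟨{x}, hx⟩ : G.IdealSheafData)).comap (redSubι G W hW)) := by
      obtain ⟨πD, hπD⟩ := exists_hom_subscheme_strictTransformIdeal_of_idealSheaf υ (vanishingIdeal ⟨{x}, hx⟩) (vanishingIdeal ⟨W, hW⟩)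
      exact ⟨πD, hπD, isBlowup_subscheme_strictTransformIdeal_of_idealSheaf hυ πD hπD⟩
    rwa [hStW] at h0
  obtain ⟨πD, hπD, hblD⟩ := hpack
  -- the point `p₀ = πD z` of `W̃` lies over `x`
  have hp₀ : redSubι G W hW (πD z) = x := by rw [← Scheme.Hom.comp_apply, hπD, Scheme.Hom.comp_apply]; exact hz
  -- the two surjections `𝒪_{X', j x} → 𝒪_{G, x} → 𝒪_{W̃, p₀}` and their composite `ψ`
  set ψ₁ := (j.stalkMap (redSubι G W hW (πD z))).hom with hψ₁
  set ψ₂ := ((redSubι G W hW).stalkMap (πD z)).hom with hψ₂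
  set ψ := ψ₂.comp ψ₁ with hψ
  -- the package at `j (ι p₀) = s 𝔪`
  have hpt : s (closedPoint O) = j (redSubι G W hW (πD z)) := by rw [hss₀, hp₀]
  rw [hpt] at hsplit
  obtain ⟨u, v, g, a, b, c, h, hS, hWst, hg, hh, hunit⟩ := hsplit
  -- `ψ` kills `𝓦_{jx} ⊇ 𝓛_{jx}`
  have hkerψ₂ : RingHom.ker ψ₂ = stalkIdeal (vanishingIdeal ⟨W, hW⟩ : G.IdealSheafData) (redSubι G W hW (πD z)) :=
    ker_stalkMap_subschemeι_eq_stalkIdeal _ (πD z)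
  have h𝓦ψ : (stalkIdeal 𝓦 (j (redSubι G W hW (πD z)))).map ψ = ⊥ := by
    rw [hψ, ← Ideal.map_map, hψ₁, ← stalkIdeal_comap_eq_map_stalkMap, h𝓦tr, Ideal.map_eq_bot_iff_le_ker, hkerψ₂]
  have h𝓛ψ : (stalkIdeal 𝓛 (j (redSubι G W hW (πD z)))).map ψ = ⊥ :=
    eq_bot_iff.mpr ((Ideal.map_mono (stalkIdeal_mono h𝓛𝓦 _)).trans h𝓦ψ.le)
  -- `𝔪_{W̃, p₀} = (ψ u, ψ v)`
  have h𝔪D : maximalIdeal ((redSub G W hW).presheaf.stalk (πD z)) = Ideal.span {ψ u, ψ v} := by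
    have h1 := stalkIdeal_comap_vanishingIdeal_singleton (redSubι G W hW) hx hp₀
    rw [← h1, stalkIdeal_comap_eq_map_stalkMap, ← hCD, stalkIdeal_comap_eq_map_stalkMap, hS, Ideal.map_map, ← hψ₁, ← hψ₂, ← hψ,
      Ideal.map_sup, h𝓛ψ, bot_sup_eq, Ideal.map_span, Set.image_pair]
  -- the relation in `𝒪_{W̃, p₀}`
  have hgψ : ψ g = 0 := by
    have hmem : g ∈ stalkIdeal 𝓦 (j (redSubι G W hW (πD z))) := by rw [hWst]; exact Ideal.mem_sup_right (Ideal.mem_span_singleton_self g)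
    have h2 := Ideal.mem_map_of_mem ψ hmem
    rw [h𝓦ψ] at h2
    exact Ideal.mem_bot.mp h2
  have hrel : ψ a * ψ u ^ 2 + ψ b * ψ u * ψ v + ψ c * ψ v ^ 2 + ψ h = 0 := by
    have h2 := congrArg ψ hg
    rw [hgψ] at h2
    simp only [map_add, map_mul, map_pow] at h2
    exact h2.symm
  have hη : ψ h ∈ Ideal.span {ψ u, ψ v} ^ 3 := by
    have h2 := Ideal.mem_map_of_mem ψ hh
    rwa [Ideal.map_sup, h𝓛ψ, bot_sup_eq, Ideal.map_pow, Ideal.map_span, Set.image_pair] at h2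
  have hdisc : IsUnit (ψ b ^ 2 - 4 * ψ a * ψ c) := by
    have h2 := hunit.map ψ
    simpa only [map_sub, map_mul, map_pow, map_ofNat] using h2
  -- the stalk of `W̃'` at `z` is a localisation of a chart of the blow-up of `𝔪 = (ψ u, ψ v)`
  set cc : Fin 2 → (redSub G W hW).presheaf.stalk (πD z) := ![ψ u, ψ v] with hcc
  have hrange : Ideal.span {ψ u, ψ v} = Ideal.span (Set.range cc) := by
    congr 1
    ext y
    simp only [Set.mem_insert_iff, Set.mem_singleton_iff, Set.mem_range, hcc]
    constructor
    · rintro (rfl | rfl)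
      · exact ⟨0, rfl⟩
      · exact ⟨1, rfl⟩
    · rintro ⟨i, rfl⟩
      fin_cases i
      · exact Or.inl rfl
      · exact Or.inr rfl
  have hcJ : Ideal.span {ψ u, ψ v} = stalkIdeal (((vanishingIdeal ⟨{x}, hx⟩ : G.IdealSheafData)).comap (redSubι G W hW)) (πD z) := by
    rw [stalkIdeal_comap_vanishingIdeal_singleton (redSubι G W hW) hx hp₀, h𝔪D]
  obtain ⟨j₀, 𝔔, χ, e, -, -, h𝔔⟩ := exists_blowupAlgebra_stalk_ringEquiv_of_eq hblD z cc (Ideal.span {ψ u, ψ v}) hrange hcJ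
  have key : IsRegularLocalRing (Localization.AtPrime 𝔔.asIdeal) := by
    fin_cases j₀
    · -- chart `ψ u ≠ 0`: the symmetric package
      exact SplitNodeChart.isRegularLocalRing_localization_of_eq (ψ v) (ψ u) (ψ c) (ψ b) (ψ a) (ψ h) (Ideal.span {ψ u, ψ v}) _
        (by rw [Set.pair_comm]) (by simp [hcc]) (by rw [h𝔪D, Set.pair_comm]) (by rw [← hrel]; ring) (by rw [Set.pair_comm]; exact hη)
        (by have : ψ b ^ 2 - 4 * ψ c * ψ a = ψ b ^ 2 - 4 * ψ a * ψ c := by ring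
            rw [this]; exact hdisc) 𝔔.asIdeal 𝔔.isPrime h𝔔 _
    · exact SplitNodeChart.isRegularLocalRing_localization_of_eq (ψ u) (ψ v) (ψ a) (ψ b) (ψ c) (ψ h) (Ideal.span {ψ u, ψ v}) _ rfl
        (by simp [hcc]) h𝔪D hrel hη hdisc 𝔔.asIdeal 𝔔.isPrime h𝔔 _
  exact @IsRegularLocalRing.of_ringEquiv _ _ key _ _ e.symm

end Summit.ResolutionOfSingularities.ResolutionOfSingularities.Cruxes.EquisingularLiftNat.Sections.Equinodal

end
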